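import Mathlib.CategoryTheory.Category.ULift
import Literature.AlgebraicGeometry.Frobenioids.FSMIMorphisms
import Literature.IUT.HodgeTheaters.GlobalFrobenioids
import Literature.IUT.HodgeTheaters.GlobalFrobenioidsArithmeticPullback
import HarnessLib

/-!
# [IUTchI] Example 5.1 (iii): `†ℱ^⊚ := †ℱ^⊛|_{†𝒟^⊚}` IS a Frobenioid for `†𝒟^⊚ = ℬ(π₁(†𝒟^⊚))⁰` — the [FrdI]
# Prop 1.6 base-change inputs DISCHARGED — and non-vacuity of the Example 5.1 (iii) data (proof-only)

Mochizuki, *Inter-universal Teichmüller theory I*, §5, Example 5.1 (iii), kurims manuscript (May 2020) pp. 125–126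
([IUTchI] Ex 5.1 (iii) p.126) [claim: Mochizuki2012, status: disputed]: "`†ℱ^⊚ := †ℱ^⊛|_{†𝒟^⊚} (→ †ℱ^⊛)` … the
restriction of `†ℱ^⊛` to `†𝒟^⊚` via the natural morphism `†𝒟^⊚ → †𝒟^⊛`", where `†𝒟^⊚` is [a category
equivalent to] `ℬ(π₁(†𝒟^⊚))⁰` for the profinite group `π₁(†𝒟^⊚)` (Example 5.1 (i), p. 123; Def 4.1 (v)).

PROOF-ONLY sequel to `GlobalFrobenioidsFrobenioidStructure.lean` (abc-iut-w4-d050, p412721: `fcirc_isFrobenioid`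
modulo the [FrdI] Thm 5.2 inputs on `(Φ^⊛, 𝔹)` AND the [FrdI] Prop 1.6 base-change inputs on `†𝒟^⊚ → †𝒟^⊛` —
`†𝒟^⊚` connected, totally epimorphic, FSM-morphisms to FSM-morphisms) and `GlobalFrobenioidsArithmeticPullback.lean`
(p417516: the Thm 5.2 inputs discharged at the arithmetic models; `ℬ(H)⁰` is of FSM-type):

* `isFSM_map_of_baseCat` — EVERY functor out of `ℬ(H)⁰` (`H` profinite) carries FSM-morphisms to FSM-morphisms,
  because in a category of FSM-type they are isomorphisms ([FrdI] §0);
* `GlobalFrobenioid.fcirc_isFrobenioid_of_baseCat` — for `†𝒟^⊚ = ℬ(H)⁰` and ANY "natural morphism"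
  `†𝒟^⊚ → †𝒟^⊛`, `†ℱ^⊚` is a Frobenioid modulo only the [FrdI] Thm 5.2 inputs on `(Φ^⊛, 𝔹)` (the three Prop 1.6
  inputs discharged: `isGraphConnected_baseCat`, `isTotallyEpimorphic_baseCat`, `isFSM_map_of_baseCat`);
* `GlobalFrobenioid.fcirc_isFrobenioid_arith_of_baseCat` / `fcirc_isFrobenioid_arithAlong_of_baseCat` — hence
  UNCONDITIONAL at the arithmetic models of Example 5.1 (ii) (`GlobalDivisorData.arith`, `arithAlong`);
* `NFBridgeRecon.mem_mbarMod_iff_of_chart` — Example 5.1 (i)'s "`𝕄̄^⊛_mod(†𝒟^⊚)` … corresponding to `F_mod`":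
  under any `ρ`-equivariant chart `𝕄̄^⊛(†𝒟^⊚) ≅ F̄` (explicit data), abc-iut-L5-t1's invariants `MbarMod` are EXACTLY
  the bottom field `F` (Krull);
* `nonempty_globalFrobenioid` — the Example 5.1 (iii) data `GlobalFrobenioid Δ †𝒟^⊚ (†𝒟^⊚ → †𝒟^⊛)` is INHABITED
  for every divisor data `Δ`, every `†𝒟^⊚` and every `†𝒟^⊚ → †𝒟^⊛` (by `†ℱ^⊛ := ℱ^⊛(†𝒟^⊚)` itself with the identity
  identification) — a vacuity guard for the "is a Frobenioid" theorems about `†ℱ^⊛`, `†ℱ^⊚`, `†ℱ^⊛_mod`.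

No definitions; no new Prop fact; no statement of the paper is strengthened; no side is taken on [IUTchIII] Cor. 3.12.
-/

namespace Literature.IUT.HodgeTheaters

open CategoryTheory Opposite Literature.AlgebraicGeometry.Frobenioids
open Literature.AlgebraicGeometry.Frobenioids.QuasiTemperoid

universe v u

/-! ### Functors out of `ℬ(H)⁰` preserve FSM-morphisms -/

/-- Every functor out of `ℬ(H)⁰`, `H` profinite, carries FSM-morphisms to FSM-morphisms: an FSM-morphism of the
FSM-type category `ℬ(H)⁰` (`isOfFSMType_baseCat`) is an isomorphism, and isomorphisms are FSM ([FrdI] §0).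
([IUTchI] Ex 5.1 (iii) p.126; [FrdI] Prop 1.6) [claim: Mochizuki2012, status: disputed] -/
theorem isFSM_map_of_baseCat {H : ProfiniteGrp.{u}} {C : Type*} [Category.{v} C] (T : BaseCat H ⥤ C)
    {A A' : BaseCat H} (f : A' ⟶ A) (hf : IsFSM f) : IsFSM (T.map f) := by
  haveI : IsIso f := (isOfFSMType_baseCat H).isIso_of_isFSM f hf
  exact IsFSM.of_isIso (T.map f)

/-! ### `†ℱ^⊚` is a Frobenioid when `†𝒟^⊚ = ℬ(π₁(†𝒟^⊚))⁰` -/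

namespace GlobalFrobenioid

section General

variable {G H : ProfiniteGrp.{u}} {Δ : GlobalDivisorData G} {toBase0 : BaseCat H ⥤ BaseCat G}
  (𝓕 : GlobalFrobenioid Δ (BaseCat H) toBase0)

/-- **[IUTchI] Ex 5.1 (iii): `†ℱ^⊚ := †ℱ^⊛|_{†𝒟^⊚}` IS a Frobenioid for `†𝒟^⊚ = ℬ(π₁(†𝒟^⊚))⁰`** — abc-iut-w4-d050's
`fcirc_isFrobenioid` with its three [FrdI] Prop 1.6 base-change inputs DISCHARGED for ANY functor
`†𝒟^⊚ = ℬ(H)⁰ → †𝒟^⊛` (`ℬ(H)⁰` is connected and totally epimorphic; functors out of it preserve FSM-morphisms);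
only the [FrdI] Thm 5.2 inputs on `(Φ^⊛, 𝔹)` remain as named hypotheses here.
([IUTchI] Ex 5.1 (iii) p.126) [claim: Mochizuki2012, status: disputed] -/
theorem fcirc_isFrobenioid_of_baseCat (hΦ : IsMonoidOn Δ.Φ)
    (hΦd : Objectwise (fun M _ => IsDivisorial M) Δ.Φ) (hB : IsMonoidOn Δ.B)
    (hBg : Objectwise (fun M _ => IsGroupLike M) Δ.B) :
    ∃ e : 𝓕.Fcirc ≌ PreFrobenioid.FiberProduct
        (𝓕.equiv.functor ⋙ ModelFrobenioid.toElem Δ.Φ Δ.B Δ.div) (𝓕.baseMor ⋙ 𝓕.identify.functor),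
      (∀ X, (e.functor.obj X).fst = X.fst ∧ (e.functor.obj X).snd = X.snd) ∧
      PreFrobenioid.IsFrobenioid (e.functor ⋙ PreFrobenioid.fiberProductFunctor
        (𝓕.equiv.functor ⋙ ModelFrobenioid.toElem Δ.Φ Δ.B Δ.div) (𝓕.baseMor ⋙ 𝓕.identify.functor)) :=
  𝓕.fcirc_isFrobenioid hΦ hΦd hB hBg (isGraphConnected_baseCat H) (isTotallyEpimorphic_baseCat H)
    (fun f hf => isFSM_map_of_baseCat (𝓕.baseMor ⋙ 𝓕.identify.functor) f hf)

end General

/-- **`†ℱ^⊚` IS a Frobenioid — UNCONDITIONAL** at the `G_F`-arithmetic model of Example 5.1 (ii)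
(`GlobalDivisorData.arith`) with `†𝒟^⊚ = ℬ(H)⁰` for any profinite `H` and any `†𝒟^⊚ → †𝒟^⊛`.
([IUTchI] Ex 5.1 (iii) p.126) [claim: Mochizuki2012, status: disputed] -/
theorem fcirc_isFrobenioid_arith_of_baseCat {F : Type} [Field F] [NumberField F] {H : ProfiniteGrp.{0}}
    {toBase0 : BaseCat H ⥤ BaseCat (absGalGrp F)}
    (𝓕 : GlobalFrobenioid (GlobalDivisorData.arith F) (BaseCat H) toBase0) :
    ∃ e : 𝓕.Fcirc ≌ PreFrobenioid.FiberProduct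
        (𝓕.equiv.functor ⋙ ModelFrobenioid.toElem _ _ (GlobalDivisorData.arith F).div)
        (𝓕.baseMor ⋙ 𝓕.identify.functor),
      (∀ X, (e.functor.obj X).fst = X.fst ∧ (e.functor.obj X).snd = X.snd) ∧
      PreFrobenioid.IsFrobenioid (e.functor ⋙ PreFrobenioid.fiberProductFunctor
        (𝓕.equiv.functor ⋙ ModelFrobenioid.toElem _ _ (GlobalDivisorData.arith F).div)
        (𝓕.baseMor ⋙ 𝓕.identify.functor)) :=
  𝓕.fcirc_isFrobenioid_of_baseCat (GlobalDivisorData.arith_isMonoidOn_Φ F) (GlobalDivisorData.arith_isDivisorial F)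
    (GlobalDivisorData.arith_isMonoidOn_B F) (GlobalDivisorData.arith_isGroupLike F)

/-- **`†ℱ^⊚` IS a Frobenioid — UNCONDITIONAL** at the pulled-back arithmetic model over a general `†𝒟^⊛ = ℬ(G)⁰`,
`ρ : π₁(†𝒟^⊛) ↠ G_F` (`GlobalDivisorData.arithAlong`), with `†𝒟^⊚ = ℬ(H)⁰` (`H = π₁(†𝒟^⊚)` profinite) and any
`†𝒟^⊚ → †𝒟^⊛`. ([IUTchI] Ex 5.1 (iii) p.126) [claim: Mochizuki2012, status: disputed] -/
theorem fcirc_isFrobenioid_arithAlong_of_baseCat {G H : ProfiniteGrp.{0}} {F : Type} [Field F] [NumberField F]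
    {ρ : G →ₜ* GalFbar F} {hρ : Function.Surjective ρ} {toBase0 : BaseCat H ⥤ BaseCat G}
    (𝓕 : GlobalFrobenioid (GlobalDivisorData.arithAlong F ρ hρ) (BaseCat H) toBase0) :
    ∃ e : 𝓕.Fcirc ≌ PreFrobenioid.FiberProduct
        (𝓕.equiv.functor ⋙ ModelFrobenioid.toElem _ _ (GlobalDivisorData.arithAlong F ρ hρ).div)
        (𝓕.baseMor ⋙ 𝓕.identify.functor),
      (∀ X, (e.functor.obj X).fst = X.fst ∧ (e.functor.obj X).snd = X.snd) ∧
      PreFrobenioid.IsFrobenioid (e.functor ⋙ PreFrobenioid.fiberProductFunctor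
        (𝓕.equiv.functor ⋙ ModelFrobenioid.toElem _ _ (GlobalDivisorData.arithAlong F ρ hρ).div)
        (𝓕.baseMor ⋙ 𝓕.identify.functor)) :=
  𝓕.fcirc_isFrobenioid_of_baseCat (GlobalDivisorData.arithAlong_isMonoidOn_Φ F ρ hρ)
    (GlobalDivisorData.arithAlong_isDivisorial F ρ hρ) (GlobalDivisorData.arithAlong_isMonoidOn_B F ρ hρ)
    (GlobalDivisorData.arithAlong_isGroupLike F ρ hρ)

end GlobalFrobenioid

/-! ### Non-vacuity of the Example 5.1 (iii) data -/

/-- **The Example 5.1 (iii) data is INHABITED** for every divisor data `Δ` on `†𝒟^⊛ = ℬ(G)⁰`, every `†𝒟^⊚`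
and every `†𝒟^⊚ → †𝒟^⊛`: take `†ℱ^⊛ := ℱ^⊛(†𝒟^⊚)` itself (with its hom-sets lifted one universe, Mathlib `ULiftHom`,
to fit the interface's universe signature; the equivalence is `ULiftHom.equiv`), `Base(†ℱ^⊛) := †𝒟^⊛` with the
model's base functor, the given `†𝒟^⊚ → †𝒟^⊛` as the morphism to the base, and identities as the witnesses of
"abstractly equivalent" — so the theorems "`†ℱ^⊛` / `†ℱ^⊚` / `†ℱ^⊛_mod` is a Frobenioid" are never about an empty
type of data. ([IUTchI] Ex 5.1 (iii) p.125) [claim: Mochizuki2012, status: disputed] -/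
theorem nonempty_globalFrobenioid {G : ProfiniteGrp.{u}} (Δ : GlobalDivisorData G) (Dcirc : Type (u + 1))
    [Category.{u} Dcirc] (toBase0 : Dcirc ⥤ BaseCat G) : Nonempty (GlobalFrobenioid Δ Dcirc toBase0) :=
  ⟨{ cat := ULiftHom.{u + 1} Δ.ModelGlobalFrobenioid
     equiv := ULiftHom.equiv.symm
     Base := BaseCat G
     toBase := ULiftHom.down ⋙ Δ.modelBase
     baseMor := toBase0
     α₁ := CategoryTheory.Equivalence.refl
     identify := CategoryTheory.Equivalence.refl
     compat := Iso.refl _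
     toBase_compat := Iso.refl _ }⟩

/-- … in particular at the arithmetic models: the type of global Frobenioids `†ℱ^⊛` over the pulled-back
arithmetic divisor data of a general `†𝒟^⊛` (`ρ : π₁(†𝒟^⊛) ↠ G_F`) with `†𝒟^⊚ = ℬ(π₁(†𝒟^⊚))⁰` is inhabited, and
for EVERY inhabitant `†ℱ^⊚` is a Frobenioid. ([IUTchI] Ex 5.1 (iii) p.126) [claim: Mochizuki2012, status: disputed] -/
theorem exists_globalFrobenioid_fcirc_isFrobenioid {G H : ProfiniteGrp.{0}} (F : Type) [Field F]
    [NumberField F] (ρ : G →ₜ* GalFbar F) (hρ : Function.Surjective ρ) (toBase0 : BaseCat H ⥤ BaseCat G) :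
    Nonempty (GlobalFrobenioid (GlobalDivisorData.arithAlong F ρ hρ) (BaseCat H) toBase0) ∧
      ∀ 𝓕 : GlobalFrobenioid (GlobalDivisorData.arithAlong F ρ hρ) (BaseCat H) toBase0,
        ∃ e : 𝓕.Fcirc ≌ PreFrobenioid.FiberProduct
            (𝓕.equiv.functor ⋙ ModelFrobenioid.toElem _ _ (GlobalDivisorData.arithAlong F ρ hρ).div)
            (𝓕.baseMor ⋙ 𝓕.identify.functor),
          PreFrobenioid.IsFrobenioid (e.functor ⋙ PreFrobenioid.fiberProductFunctor
            (𝓕.equiv.functor ⋙ ModelFrobenioid.toElem _ _ (GlobalDivisorData.arithAlong F ρ hρ).div)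
            (𝓕.baseMor ⋙ 𝓕.identify.functor)) :=
  ⟨nonempty_globalFrobenioid _ _ _, fun 𝓕 => by
    obtain ⟨e, -, he⟩ := 𝓕.fcirc_isFrobenioid_arithAlong_of_baseCat
    exact ⟨e, he⟩⟩

/-- The hypotheses of the pulled-back model are themselves satisfiable: `G := G_F`, `ρ := id` is a profinite group with
a continuous surjection onto `G_F` (so `arithAlong` specialises to [FrdI] Example 6.3's own base `ℬ(G_F)⁰`).
([IUTchI] Ex 5.1 (i) p.123) [claim: Mochizuki2012, status: disputed] -/
theorem exists_profinite_surjective_toGal (F : Type) [Field F] [NumberField F] :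
    ∃ (G : ProfiniteGrp.{0}) (ρ : G →ₜ* GalFbar F), Function.Surjective ρ :=
  ⟨absGalGrp F, ContinuousMonoidHom.id (GalFbar F), Function.surjective_id⟩

/-! ### Example 5.1 (i)'s `𝕄̄^⊛_mod(†𝒟^⊚)` "corresponding to `F_mod`" under a chart of the reconstructed field -/

/-- **[IUTchI] Ex 5.1 (i), "by taking `π₁(†𝒟^⊛)`-invariants, we obtain a … subfield `𝕄̄^⊛_mod(†𝒟^⊚) ⊆ 𝕄̄^⊛(†𝒟^⊚)`
corresponding to `F_mod ⊆ F̄`" (p. 123) — PROVED for abc-iut-L5-t1's interface `NFBridgeRecon` under any CHART of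
the reconstructed field**: if the `π₁(†𝒟^⊛)`-field `𝕄̄^⊛(†𝒟^⊚)` (`N.Fbar`) is identified with `F̄` by a ring
isomorphism `e` that is equivariant along a surjection `ρ : π₁(†𝒟^⊛) ↠ G_F` (print's "isomorph of `F̄`" with
"its natural `π₁(†𝒟^⊛)`-action", `F` in the role of `F_mod`), then `N.MbarMod` (t1's REAL definition, the
invariants) corresponds under `e` EXACTLY to the bottom field `F ⊆ F̄` (Krull: the fixed field of all of `G_F`).
Proof-only; `ρ`, `e` are explicit data, not a new fact. ([IUTchI] Ex 5.1 (i) p.123) [claim: Mochizuki2012, status: disputed] -/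
theorem NFBridgeRecon.mem_mbarMod_iff_of_chart (N : NFBridgeRecon.{0}) (F : Type) [Field F] [NumberField F]
    (ρ : N.piDast →* QuasiTemperoid.GalFbar F) (hρ : Function.Surjective ρ) (e : N.Fbar ≃+* QuasiTemperoid.Fbar F)
    (he : ∀ (g : N.piDast) (x : N.Fbar), e (g • x) = ρ g (e x)) (x : N.Fbar) :
    x ∈ N.MbarMod ↔ e x ∈ (⊥ : IntermediateField F (QuasiTemperoid.Fbar F)) := by
  haveI : IsGalois F (QuasiTemperoid.Fbar F) := isGalois_fbar F
  have hmem : x ∈ N.MbarMod ↔ ∀ g : N.piDast, g • x = x := Iff.rfl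
  rw [hmem, ← InfiniteGalois.fixedField_fixingSubgroup (⊥ : IntermediateField F (QuasiTemperoid.Fbar F)),
    IntermediateField.fixingSubgroup_bot, IntermediateField.mem_fixedField_iff]
  constructor
  · intro hx σ _
    obtain ⟨g, rfl⟩ := hρ σ
    rw [← he, hx g]
  · intro h g
    apply e.injective
    rw [he]
    exact h (ρ g) (Subgroup.mem_top _)

end Literature.IUT.HodgeTheaters
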